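import Literature.NumberTheory.LFunctions.RiemannHypothesisUpToRSCertificate
import Literature.NumberTheory.LFunctions.TuringMethodWindow
import Literature.NumberTheory.LFunctions.TuringMethodProofs
import HarnessLib

/-!
# SigmaL / BC5 rung W0 — the two Turing inequalities of a window certificate, checked in intervals

Route `RiemannHypothesis/HardyZLehmerSplit`, item `SigmaL` (stmt-RiemannHypothesis-24253), tribunal
seat `rh-trib-w-sigmaL-1`. COMPUTATIONAL SUPPORT ONLY: nothing here bears on the truth of RH.

To bound the number of zeros of `ζ` with ordinate in a window `(T₁, T₂)` one needs `N(T₂) ≤ n₂`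
(Turing's method ABOVE `T₂`) and `n₁ < N(T₁)` (Turing's method BELOW `T₁`,
`Literature.NumberTheory.LFunctions.lt_zetaZeroCount_of_sign_changes_below`). Both use the PROVED
bound `|∫_{t₁}^{t₂} S| ≤ 2.067 + 0.059 log t₂` (`abs_integral_zetaArgS_le_trudgian_holds`,
Trudgian 2011 Thm 2.2) and the Stirling primitive `G = RSCert.thetaMainPrim` for `∫ ϑ`:
* `le_integral_riemannSiegelTheta` — the LOWER companion of `RSCert.integral_riemannSiegelTheta_le`;
* `checkUpWith` / `hup_of_checkUpWith` — `RSCert.checkHnumWith` with Trudgian's constant;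
* `checkLowWith` / `hlow_of_checkLowWith` — the mirror-image check below a height;
* `zetaZeroCount_window_le_of_runs` — from two certified sign runs (`RSCert.AltRun`) and the two
  checks: `N(T₂) ≤ n₂ ∧ n₁ < N(T₁)`.

[cite: EdwardsZeta1974, §8.2 (1)]; [cite: Trudgian2011, Thm 2.2]; [cite: Brent1979, Thm. 3.2].
-/

set_option linter.dupNamespace false
set_option autoImplicit false

open Finset Complex MeasureTheory
open Literature.Analysis.ValidatedNumerics Literature.Analysis.ValidatedNumerics.NumericsMP
open Literature.NumberTheory.LFunctions Literature.NumberTheory.LFunctions.ZetaNumerics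
open Literature.NumberTheory.LFunctions.RSEval Literature.NumberTheory.LFunctions.RSCert
open scoped Real

namespace Summit.RiemannHypothesis.RiemannHypothesis.Theorems.SigmaLCert

/-! ## 1. Lower bound for `∫ ϑ` -/

/-- **Lower bound for `∫ ϑ`**: for `2 ≤ T`, `0 ≤ h`,
`G(T+h) − G(T) − 2K(¼) h / T ≤ ∫_T^{T+h} ϑ(t) dt` (from `|ϑ − ϑ_m| ≤ 2K(¼)/t` and `G' = ϑ_m`; the
companion of `RSCert.integral_riemannSiegelTheta_le`). [cite: EdwardsZeta1974, §6.5 and §8.2] -/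
theorem le_integral_riemannSiegelTheta {T h : ℝ} (hT : 2 ≤ T) (hh : 0 ≤ h) :
    thetaMainPrim (T + h) - thetaMainPrim T - 2 * stirlingVertRate (1 / 4) * h / T ≤
      ∫ t in T..T + h, riemannSiegelTheta t := by
  have hT0 : 0 < T := by linarith
  set c : ℝ := 2 * stirlingVertRate (1 / 4) / T with hc
  have hK : 0 ≤ stirlingVertRate (1 / 4) := by unfold stirlingVertRate; positivity
  have hpt : ∀ t ∈ Set.Icc T (T + h),
      (t / 2 * Real.log (t / (2 * π)) - t / 2 - π / 8) - c ≤ riemannSiegelTheta t := by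
    intro t ht
    have ht2 : 2 ≤ t := hT.trans ht.1
    have ht0 : 0 < t := by linarith
    have h1 := (abs_le.1 (abs_riemannSiegelTheta_sub_stirling_le ht2)).1
    have h2 : 2 * stirlingVertRate (1 / 4) / t ≤ c := by
      rw [hc]
      exact div_le_div_of_nonneg_left (by positivity) hT0 ht.1
    linarith
  have hcont0 : ContinuousOn (fun t : ℝ ↦ t / 2 * Real.log (t / (2 * π)) - t / 2 - π / 8)
      (Set.uIcc T (T + h)) := by
    intro t ht
    rw [Set.uIcc_of_le (by linarith)] at ht
    have ht0 : 0 < t := by linarith [ht.1]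
    apply ContinuousAt.continuousWithinAt
    have hl : ContinuousAt (fun z : ℝ ↦ Real.log (z / (2 * π))) t :=
      ContinuousAt.log (continuousAt_id.div_const (2 * π))
        (by simpa using (div_pos ht0 (by positivity : (0 : ℝ) < 2 * π)).ne')
    exact (((continuousAt_id.div_const (2 : ℝ)).mul hl).sub (continuousAt_id.div_const (2 : ℝ))).sub
      continuousAt_const
  have hcont : ContinuousOn (fun t : ℝ ↦ (t / 2 * Real.log (t / (2 * π)) - t / 2 - π / 8) - c)
      (Set.uIcc T (T + h)) := hcont0.sub continuousOn_const
  have hderiv : ∀ x ∈ Set.uIcc T (T + h),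
      HasDerivAt thetaMainPrim (x / 2 * Real.log (x / (2 * π)) - x / 2 - π / 8) x := by
    intro x hx
    rw [Set.uIcc_of_le (by linarith)] at hx
    exact hasDerivAt_thetaMainPrim (by linarith [hx.1])
  have hmono := intervalIntegral.integral_mono_on (by linarith : T ≤ T + h)
    hcont.intervalIntegrable (intervalIntegrable_riemannSiegelTheta T (T + h)) hpt
  refine le_trans (le_of_eq ?_) hmono
  rw [intervalIntegral.integral_sub hcont0.intervalIntegrable intervalIntegrable_const,
    intervalIntegral.integral_const, smul_eq_mul,
    intervalIntegral.integral_eq_sub_of_hasDerivAt hderiv hcont0.intervalIntegrable, hc]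
  ring

/-! ## 2. The check above a height (Turing–Trudgian) -/

/-- **The Turing inequality check above `T₀`** for the claim `N(T₀) ≤ n` with the found-zero run
`(q₀, M)` on `[T₀, T₀ + h]` (unit `2^{-e}`): an upper bound of
`2.067 + 0.059 log(T₀+h) + (G(T₀+h) − G(T₀) + 2K(¼)h/T₀)/π + h − Σ_{j=1}^{m}(T₀ + h − s_j)` is
`< h(n + 1)` (`RSCert.checkHnumWith` with Trudgian's constant). [cite: EdwardsZeta1974, §8.2 (1)] -/
def checkUpWith (R : RSTables) (e T0 h n q0 : ℕ) (M : List ℕ) : Bool :=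
  let S := R.T.S
  match logNatK S R.Klog (T0 + h), thetaMainPrimBox R (T0 + h), thetaMainPrimBox R T0,
    MI.divPos S (R.twoK.mulInt (h : ℤ)) (MI.ofInt S T0) with
  | some lTh, some G1, some G0, some K =>
    let A := (MI.ofFrac S 2067 1000).add ((lTh.mulInt 59).divNat 1000)
    match MI.divPos S ((G1.sub G0).add K) R.T.piI with
    | some I =>
      let sigma := MI.ofFrac S ((M.length * (T0 + h) * 2 ^ e : ℕ) - (sumPts q0 M : ℤ)) (2 ^ e)
      let lhs := ((A.add I).add (MI.ofInt S h)).sub sigma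
      decide (lhs.hi < ((h * (n + 1) : ℕ) : ℤ) * S)
    | none => false
  | _, _, _, _ => false

/-- Soundness of `checkUpWith`: the real Turing inequality with `∫ ϑ` bounded by
`RSCert.integral_riemannSiegelTheta_le`. [cite: EdwardsZeta1974, §8.2 (1)] -/
theorem hup_of_checkUpWith {R : RSTables} (hR : R.Valid) {e T0 h n q0 : ℕ} {M : List ℕ}
    (hT2 : 2 ≤ T0) (hc : checkUpWith R e T0 h n q0 M = true) :
    2.067 + 0.059 * Real.log ((T0 : ℝ) + h)
        + (∫ t in (T0 : ℝ)..(T0 : ℝ) + h, (riemannSiegelTheta t / π + 1))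
        - ((M.length : ℝ) * ((T0 : ℝ) + h) - (sumPts q0 M : ℝ) / 2 ^ e)
        < (h : ℝ) * (n + 1) := by
  have hS := hR.T_valid.S_pos
  have hSr : (0 : ℝ) < R.T.S := by exact_mod_cast hS
  have hpi := hR.T_valid.mem_pi
  have hT0r : (2 : ℝ) ≤ T0 := by exact_mod_cast hT2
  have hT0pos : (0 : ℝ) < T0 := by linarith
  unfold checkUpWith at hc
  simp only at hc
  split at hc
  · rename_i lTh G1 G0 K hlTh hG1 hG0 hK
    split at hc
    · rename_i I hI
      have hdec := of_decide_eq_true hc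
      rw [logNatK_eq] at hlTh
      have hTh1 : 1 ≤ T0 + h := by omega
      -- A ∋ 2.067 + 0.059 log(T0+h)
      have hlog : MI.mem R.T.S (Real.log ((T0 : ℝ) + h)) lTh := by
        have := MI.mem_logNat hS hlTh
        push_cast at this
        exact this
      have hA : MI.mem R.T.S (2.067 + 0.059 * Real.log ((T0 : ℝ) + h))
          ((MI.ofFrac R.T.S 2067 1000).add ((lTh.mulInt 59).divNat 1000)) := by
        have := MI.mem_add (MI.mem_ofFrac R.T.S 2067 (q := 1000) (by norm_num))
          (MI.mem_divNat (MI.mem_mulInt hlog 59) (n := 1000) (by norm_num))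
        convert this using 1
        norm_num; ring
      -- I ∋ (G(T0+h) − G(T0) + 2K h/T0)/π  ≥ ∫ θ/π
      have hG1' := mem_thetaMainPrimBox hR hTh1 hG1
      have hG0' := mem_thetaMainPrimBox hR (by omega) hG0
      have hK' : MI.mem R.T.S (2 * stirlingVertRate (1 / 4) * h / T0) K := by
        have := MI.mem_divPos hS hK (MI.mem_mulInt hR.mem_twoK (h : ℤ)) (MI.mem_ofInt R.T.S (T0 : ℤ))
        convert this using 1
        push_cast; ring
      have hI' : MI.mem R.T.S ((thetaMainPrim ((T0 : ℝ) + h) - thetaMainPrim T0 +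
          2 * stirlingVertRate (1 / 4) * h / T0) / π) I := by
        have := MI.mem_divPos hS hI (MI.mem_add (MI.mem_sub hG1' hG0') hK') hpi
        convert this using 2
        push_cast; ring
      -- sigma
      have hsig : MI.mem R.T.S ((M.length : ℝ) * ((T0 : ℝ) + h) - (sumPts q0 M : ℝ) / 2 ^ e)
          (MI.ofFrac R.T.S ((M.length * (T0 + h) * 2 ^ e : ℕ) - (sumPts q0 M : ℤ)) (2 ^ e)) := by
        have := MI.mem_ofFrac R.T.S (((M.length * (T0 + h) * 2 ^ e : ℕ) : ℤ) - (sumPts q0 M : ℤ))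
          (q := 2 ^ e) (by positivity)
        convert this using 1
        push_cast
        field_simp
      have hh : MI.mem R.T.S (h : ℝ) (MI.ofInt R.T.S h) := by exact_mod_cast MI.mem_ofInt R.T.S (h : ℤ)
      have hlhs := MI.mem_sub (MI.mem_add (MI.mem_add hA hI') hh) hsig
      have hup := hlhs.2
      -- the integral
      have hint : (∫ t in (T0 : ℝ)..(T0 : ℝ) + h, (riemannSiegelTheta t / π + 1)) ≤
          (thetaMainPrim ((T0 : ℝ) + h) - thetaMainPrim T0 + 2 * stirlingVertRate (1 / 4) * h / T0) / π
            + h := by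
        have hθint := intervalIntegrable_riemannSiegelTheta (T0 : ℝ) ((T0 : ℝ) + h)
        rw [intervalIntegral.integral_add (hθint.div_const π) intervalIntegrable_const,
          intervalIntegral.integral_const, smul_eq_mul, mul_one, intervalIntegral.integral_div]
        have h1 := integral_riemannSiegelTheta_le (T := (T0 : ℝ)) (h := (h : ℝ)) hT0r (by positivity)
        have h2 := div_le_div_of_nonneg_right h1 Real.pi_pos.le
        have : (T0 : ℝ) + h - T0 = h := by ring
        rw [this]
        linarith
      -- read off
      have hdec' : ((((((MI.ofFrac R.T.S 2067 1000).add ((lTh.mulInt 59).divNat 1000)).add I).add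
          (MI.ofInt R.T.S ↑h)).sub (MI.ofFrac R.T.S (↑(M.length * (T0 + h) * 2 ^ e) -
          ↑(sumPts q0 M)) (2 ^ e))).hi : ℝ) < ((h * (n + 1) : ℕ) : ℝ) * R.T.S := by
        exact_mod_cast hdec
      have key : (2.067 + 0.059 * Real.log ((T0 : ℝ) + h) +
          ((thetaMainPrim ((T0 : ℝ) + h) - thetaMainPrim T0 + 2 * stirlingVertRate (1 / 4) * h / T0) / π)
          + h - ((M.length : ℝ) * ((T0 : ℝ) + h) - (sumPts q0 M : ℝ) / 2 ^ e)) * R.T.S <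
          ((h * (n + 1) : ℕ) : ℝ) * R.T.S := lt_of_le_of_lt hup hdec'
      have key' := lt_of_mul_lt_mul_right key hSr.le
      push_cast at key' ⊢
      nlinarith [key', hint]
    · simp at hc
  · simp at hc

/-! ## 3. The check below a height -/

/-- **The Turing inequality check below `T₀ + h`** for the claim `n < N(T₀ + h)` with the found-zero
run `(q₀, M)` on `[T₀, T₀ + h]` (unit `2^{-e}`, `m = |M|` sign changes at points `s₀ < ⋯ < s_m`):
a lower bound of `Σ_{i<m} (s_i − T₀) + (G(T₀+h) − G(T₀) − 2K(¼)h/T₀)/π + h − (2.067 + 0.059 log(T₀+h))`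
is `> h n`. Here `Σ_{i<m} s_i · 2^e = sumPts q₀ M − ΣM` (all points but the last).
[cite: Brent1979, Thm. 3.2] -/
def checkLowWith (R : RSTables) (e T0 h n q0 : ℕ) (M : List ℕ) : Bool :=
  let S := R.T.S
  match logNatK S R.Klog (T0 + h), thetaMainPrimBox R (T0 + h), thetaMainPrimBox R T0,
    MI.divPos S (R.twoK.mulInt (h : ℤ)) (MI.ofInt S T0) with
  | some lTh, some G1, some G0, some K =>
    let A := (MI.ofFrac S 2067 1000).add ((lTh.mulInt 59).divNat 1000)
    match MI.divPos S ((G1.sub G0).sub K) R.T.piI with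
    | some I =>
      let sigma := MI.ofFrac S ((sumPts q0 M : ℤ) - (M.sum : ℤ) - ((M.length * T0 * 2 ^ e : ℕ) : ℤ))
        (2 ^ e)
      let rhs := ((sigma.add I).add (MI.ofInt S h)).sub A
      decide (((h * n : ℕ) : ℤ) * S < rhs.lo)
    | none => false
  | _, _, _, _ => false

/-- Soundness of `checkLowWith`: the real lower Turing inequality with `∫ ϑ` bounded below by
`le_integral_riemannSiegelTheta`. [cite: Brent1979, Thm. 3.2] -/
theorem hlow_of_checkLowWith {R : RSTables} (hR : R.Valid) {e T0 h n q0 : ℕ} {M : List ℕ}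
    (hT2 : 2 ≤ T0) (hc : checkLowWith R e T0 h n q0 M = true) :
    (h : ℝ) * n < (((sumPts q0 M : ℝ) - M.sum) / 2 ^ e - (M.length : ℝ) * T0)
        + (∫ t in (T0 : ℝ)..(T0 : ℝ) + h, (riemannSiegelTheta t / π + 1))
        - (2.067 + 0.059 * Real.log ((T0 : ℝ) + h)) := by
  have hS := hR.T_valid.S_pos
  have hSr : (0 : ℝ) < R.T.S := by exact_mod_cast hS
  have hpi := hR.T_valid.mem_pi
  have hT0r : (2 : ℝ) ≤ T0 := by exact_mod_cast hT2
  have hT0pos : (0 : ℝ) < T0 := by linarith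
  unfold checkLowWith at hc
  simp only at hc
  split at hc
  · rename_i lTh G1 G0 K hlTh hG1 hG0 hK
    split at hc
    · rename_i I hI
      have hdec := of_decide_eq_true hc
      rw [logNatK_eq] at hlTh
      have hTh1 : 1 ≤ T0 + h := by omega
      have hlog : MI.mem R.T.S (Real.log ((T0 : ℝ) + h)) lTh := by
        have := MI.mem_logNat hS hlTh
        push_cast at this
        exact this
      have hA : MI.mem R.T.S (2.067 + 0.059 * Real.log ((T0 : ℝ) + h))
          ((MI.ofFrac R.T.S 2067 1000).add ((lTh.mulInt 59).divNat 1000)) := by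
        have := MI.mem_add (MI.mem_ofFrac R.T.S 2067 (q := 1000) (by norm_num))
          (MI.mem_divNat (MI.mem_mulInt hlog 59) (n := 1000) (by norm_num))
        convert this using 1
        norm_num; ring
      have hG1' := mem_thetaMainPrimBox hR hTh1 hG1
      have hG0' := mem_thetaMainPrimBox hR (by omega) hG0
      have hK' : MI.mem R.T.S (2 * stirlingVertRate (1 / 4) * h / T0) K := by
        have := MI.mem_divPos hS hK (MI.mem_mulInt hR.mem_twoK (h : ℤ)) (MI.mem_ofInt R.T.S (T0 : ℤ))
        convert this using 1
        push_cast; ring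
      have hI' : MI.mem R.T.S ((thetaMainPrim ((T0 : ℝ) + h) - thetaMainPrim T0 -
          2 * stirlingVertRate (1 / 4) * h / T0) / π) I := by
        have := MI.mem_divPos hS hI (MI.mem_sub (MI.mem_sub hG1' hG0') hK') hpi
        convert this using 2
        push_cast; ring
      have hsig : MI.mem R.T.S (((sumPts q0 M : ℝ) - M.sum) / 2 ^ e - (M.length : ℝ) * T0)
          (MI.ofFrac R.T.S ((sumPts q0 M : ℤ) - (M.sum : ℤ) - ((M.length * T0 * 2 ^ e : ℕ) : ℤ))
            (2 ^ e)) := by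
        have := MI.mem_ofFrac R.T.S ((sumPts q0 M : ℤ) - (M.sum : ℤ) - ((M.length * T0 * 2 ^ e : ℕ) : ℤ))
          (q := 2 ^ e) (by positivity)
        convert this using 1
        simp only [Int.cast_sub, Int.cast_natCast, Int.cast_mul, Int.cast_pow, Int.cast_ofNat,
          Nat.cast_mul, Nat.cast_pow, Nat.cast_ofNat]
        field_simp
      have hh : MI.mem R.T.S (h : ℝ) (MI.ofInt R.T.S h) := by exact_mod_cast MI.mem_ofInt R.T.S (h : ℤ)
      have hrhs := MI.mem_sub (MI.mem_add (MI.mem_add hsig hI') hh) hA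
      have hlo := hrhs.1
      have hint : (thetaMainPrim ((T0 : ℝ) + h) - thetaMainPrim T0 - 2 * stirlingVertRate (1 / 4) * h / T0) / π
            + h ≤ (∫ t in (T0 : ℝ)..(T0 : ℝ) + h, (riemannSiegelTheta t / π + 1)) := by
        have hθint := intervalIntegrable_riemannSiegelTheta (T0 : ℝ) ((T0 : ℝ) + h)
        rw [intervalIntegral.integral_add (hθint.div_const π) intervalIntegrable_const,
          intervalIntegral.integral_const, smul_eq_mul, mul_one, intervalIntegral.integral_div]
        have h1 := le_integral_riemannSiegelTheta (T := (T0 : ℝ)) (h := (h : ℝ)) hT0r (by positivity)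
        have h2 := div_le_div_of_nonneg_right h1 Real.pi_pos.le
        have : (T0 : ℝ) + h - T0 = h := by ring
        rw [this]
        linarith
      have hdec' : ((h * n : ℕ) : ℝ) * R.T.S < ((((((MI.ofFrac R.T.S ((sumPts q0 M : ℤ) - (M.sum : ℤ) -
          ((M.length * T0 * 2 ^ e : ℕ) : ℤ)) (2 ^ e)).add I).add (MI.ofInt R.T.S ↑h)).sub
          ((MI.ofFrac R.T.S 2067 1000).add ((lTh.mulInt 59).divNat 1000))).lo : ℝ)) := by
        exact_mod_cast hdec
      have key : ((h * n : ℕ) : ℝ) * R.T.S <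
          ((((sumPts q0 M : ℝ) - M.sum) / 2 ^ e - (M.length : ℝ) * T0) +
            (thetaMainPrim ((T0 : ℝ) + h) - thetaMainPrim T0 - 2 * stirlingVertRate (1 / 4) * h / T0) / π
            + h - (2.067 + 0.059 * Real.log ((T0 : ℝ) + h))) * R.T.S := lt_of_lt_of_le hdec' hlo
      have key' := lt_of_mul_lt_mul_right key hSr.le
      push_cast at key' ⊢
      linarith [key', hint]
    · simp at hc
  · simp at hc

/-! ## 4. The window count from two runs -/

/-- `168π < 528`. [folklore] -/
lemma pi_168_lt_528 : 168 * π < (528 : ℝ) := by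
  have := Real.pi_lt_d4; nlinarith

/-- **Both ends of a window from certified runs.** An upper run `AltRun e q₀ s M` inside
`[T₂, T₂ + h]` with `checkUpWith … T₂ h n₂ …` gives `N(T₂) ≤ n₂`; a lower run `AltRun e q₀' s' M'`
inside `[T₁ − h, T₁]` with `checkLowWith … (T₁ − h) h n₁ …` gives `n₁ < N(T₁)` (`528 + h ≤ T₁`, so
Trudgian's bound applies: `abs_integral_zetaArgS_le_trudgian_holds`). [cite: Brent1979, Thm. 3.2] -/
theorem zetaZeroCount_window_le_of_runs {R : RSTables} (hR : R.Valid)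
    {e T1 T2 h n1 n2 q0 q0' : ℕ} {s s' : Bool} {M M' : List ℕ}
    (hup : AltRun e q0 s M) (hq0 : T2 * 2 ^ e ≤ q0) (hqend : q0 + M.sum ≤ (T2 + h) * 2 ^ e)
    (hlow : AltRun e q0' s' M') (hq0' : (T1 - h) * 2 ^ e ≤ q0') (hqend' : q0' + M'.sum ≤ T1 * 2 ^ e)
    (hh : 0 < h) (hT1 : 528 + h ≤ T1) (hT12 : T1 ≤ T2)
    (hcu : checkUpWith R e T2 h n2 q0 M = true) (hcl : checkLowWith R e (T1 - h) h n1 q0' M' = true) :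
    zetaZeroCount (T2 : ℝ) ≤ n2 ∧ n1 < zetaZeroCount (T1 : ℝ) := by
  have h2e : (0 : ℝ) < 2 ^ e := by positivity
  have hhr : (0 : ℝ) < h := by exact_mod_cast hh
  have hT1r : (528 : ℝ) + h ≤ T1 := by exact_mod_cast hT1
  have hT12r : (T1 : ℝ) ≤ T2 := by exact_mod_cast hT12
  have hsub : ((T1 - h : ℕ) : ℝ) = (T1 : ℝ) - h := by
    rw [Nat.cast_sub (by omega)]
  have hA := abs_integral_zetaArgS_le_trudgian_holds
  constructor
  · -- above T2
    obtain ⟨sv, hs, hs0, hsm, hssign, hssum⟩ := exists_fin_of_altRun M q0 s hup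
    have hs0' : (T2 : ℝ) ≤ sv 0 := by
      rw [hs0, le_div_iff₀ h2e]; exact_mod_cast hq0
    have hsm' : sv (Fin.last M.length) ≤ (T2 : ℝ) + h := by
      rw [hsm, div_le_iff₀ h2e]; exact_mod_cast hqend
    obtain ⟨Z, hZ, hsumZ⟩ := exists_finset_zeros_above_of_sign_changes sv hs hs0' hsm' hssign
    have hSup : ∫ t in (T2 : ℝ)..(T2 : ℝ) + h, zetaArgS t ≤ 2.067 + 0.059 * Real.log ((T2 : ℝ) + h) :=
      (abs_le.1 (hA (by linarith [pi_168_lt_528]) (by linarith))).2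
    have hineq := hup_of_checkUpWith hR (by omega) hcu
    have hsum_eq : ∑ i : Fin M.length, ((T2 : ℝ) + h - sv i.succ) =
        (M.length : ℝ) * ((T2 : ℝ) + h) - (sumPts q0 M : ℝ) / 2 ^ e := by
      rw [Finset.sum_sub_distrib, hssum, Finset.sum_const, Finset.card_univ, Fintype.card_fin,
        nsmul_eq_mul]
    refine zetaZeroCount_le_of_turing (by linarith) hhr.le Z hZ hSup ?_
    rw [hsum_eq] at hsumZ
    linarith
  · -- below T1
    obtain ⟨sv, hs, hs0, hsm, hssign, hssum⟩ := exists_fin_of_altRun M' q0' s' hlow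
    have hs0' : (T1 : ℝ) - h ≤ sv 0 := by
      rw [hs0, le_div_iff₀ h2e, ← hsub]; exact_mod_cast hq0'
    have hsm' : sv (Fin.last M'.length) ≤ (T1 : ℝ) := by
      rw [hsm, div_le_iff₀ h2e]; exact_mod_cast hqend'
    have hSlow : -(2.067 + 0.059 * Real.log (T1 : ℝ)) ≤ ∫ t in ((T1 : ℝ) - h)..(T1 : ℝ), zetaArgS t :=
      (abs_le.1 (hA (by linarith [pi_168_lt_528]) (by linarith))).1
    have hineq := hlow_of_checkLowWith hR (T0 := T1 - h) (by omega) hcl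
    rw [hsub] at hineq
    have hT1h : (T1 : ℝ) - h + h = T1 := by ring
    rw [hT1h] at hineq
    -- Σ_i sv i.castSucc = (sumPts − ΣM') / 2^e
    have hcast : ∑ i : Fin M'.length, sv i.castSucc = ((sumPts q0' M' : ℝ) - M'.sum) / 2 ^ e := by
      have h1 := Fin.sum_univ_castSucc sv
      have h2 := Fin.sum_univ_succ sv
      rw [hssum, hs0] at h2
      rw [hsm] at h1
      have : ∑ i : Fin M'.length, sv i.castSucc =
          (q0' : ℝ) / 2 ^ e + (sumPts q0' M' : ℝ) / 2 ^ e - ((q0' + M'.sum : ℕ) : ℝ) / 2 ^ e := by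
        linarith
      rw [this]; push_cast; ring
    have hsum_eq : ∑ i : Fin M'.length, (sv i.castSucc - ((T1 : ℝ) - h)) =
        ((sumPts q0' M' : ℝ) - M'.sum) / 2 ^ e - (M'.length : ℝ) * ((T1 : ℝ) - h) := by
      rw [Finset.sum_sub_distrib, hcast, Finset.sum_const, Finset.card_univ, Fintype.card_fin,
        nsmul_eq_mul]
    refine lt_zetaZeroCount_of_sign_changes_below (by linarith) hhr.le sv hs hs0' hsm' hssign hSlow ?_
    rw [hsum_eq]
    linarith

end Summit.RiemannHypothesis.RiemannHypothesis.Theorems.SigmaLCert
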